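import Literature.AlgebraicGeometry.ShimuraVarieties.UnitaryBallSpecialCycleClosed
import Literature.AlgebraicGeometry.ShimuraVarieties.UnitaryBallQuotientSurface
import Literature.Geometry.Kaehler.RegularPointStraightening
import HarnessLib

/-!
# Special cycles of compact ball quotients are analytic subsets of the expected codimension

Topic `AlgebraicGeometry/ShimuraVarieties`; namespace
`Literature.AlgebraicGeometry.ShimuraVarieties` (datum API dotted on `UnitaryBallUniformisationDatum`).
Continuation of `UnitaryBallSpecialCycleFinite` / `UnitaryBallSpecialCycleClosed`. For a unitary
ball-quotient datum `D : UnitaryBallUniformisationDatum 2 X`, a Sylvester frame `𝔣` and an `E`-subspace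
`W ⊆ V = E³`, the SPECIAL CYCLE of `W` on the compact complex surface `S(Γ) = Δ\𝔹²`
(`D.quotientSurface 𝔣`, a complex manifold modelled on `ℂ²` which IS the analytification of `X`,
`UnitaryBallQuotientSurface.isAnalytification_quotientSurface`) is the image
`D.specialCycle 𝔣 W = π(⋃_γ 𝔹((γW)^⊥))` of the special locus under the projection `π : 𝔹² → S(Γ)`.
We PROVE:

* `isAnalyticSet_specialCycle` — the special cycle is a (closed) ANALYTIC SUBSET of `S(Γ)`
  (`Literature.Geometry.Kaehler.IsAnalyticSet`): near `π z` the projection has a holomorphic local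
  inverse `σ` (`isLocalDiffeomorph_quotientSurfaceMk`), the special locus near `z` is a finite union of
  special sub-balls `𝔹((γⱼW)^⊥)` (`exists_isOpen_specialLocus_inter_eq`), each cut out by the affine
  functions `u ↦ ⟪τ₁(γⱼ bᵢ), T(u,1)⟫` of the ball coordinates (`bᵢ` a basis of `W`), so the cycle is the
  common zero set of the holomorphic functions `∏ⱼ ⟪τ₁(γⱼ b_{σ(j)}), T(σ(·),1)⟫`;
* `finrank_le_of_isRegularPointOfCodim` — at a regular point of codimension `q` of the special cycle,
  `dim_E W ≤ q` (the cycle has complex codimension `≥ dim_E W` everywhere on its regular locus): by the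
  straightening chart of a regular point (holomorphic implicit function theorem,
  `Literature.Geometry.Kaehler.exists_straightening_of_hasStrictFDerivAt`, here with the dimension count
  `dim K + q = 2`) a regular point of codimension `0` is interior — impossible for `W ≠ 0`
  (`interior_specialLocus_eq_empty`) — and a regular point of codimension `1` is not isolated — impossible
  for `dim_E W = 2`, where the special locus is discrete (`finite_specialLocus_inter_of_finrank_eq_two`);
  `dim_E W = 3` gives an empty cycle (`specialLocus_top`);
* `preimage_quotientSurfaceHomeomorph_image_specialBall` — under `S(Γ) ≃ₜ X(ℂ)` the special cycle
  is the preimage of the datum's special cycle `ballUnifMap '' 𝔹(W^⊥) = unif '' subCone(τ₁ W)`.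

These are the two inputs of Chow's theorem and of the GAGA dimension comparison
(`chow_analyticSet_analytification_holds`, `gaga_le_coheight_of_regularLocus_codim_holds`) in the proof of
`PicardCM.SpecialCyclesAlgebraic` (Kudla–Millson 1990, p. 133: "In case `G = U(p, q)`, the cycle `C_β`
is an algebraic cycle"; Bergeron–Millson–Moeglin 2016, Introduction §1.7: special cycles of complex
codimension `n q = dim W` in `S = Γ\𝔹²`).

References: S. Kudla, J. Millson, Publ. Math. IHÉS 71 (1990), Lemma 1.1 p. 128 and p. 133;
N. Bergeron, J. Millson, C. Moeglin, Acta Math. 216 (2016), Introduction §1.7, Part 2 §§3.2–3.3;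
P. Griffiths, J. Harris, *Principles of Algebraic Geometry* (1978), Ch. 0 §§1–2.

## Provenance

Written for the pub-hodgecm2 (COR-CM) cell, lane SPECIAL-CYCLES (seat b06): third of the files proving
the record `Literature.NumberTheory.Automorphic.PicardCM.SpecialCyclesAlgebraic`. Nothing in this file is
a claim of the manuscripts adjudicated by that cell.
-/

set_option autoImplicit false

noncomputable section

open scoped Manifold ContDiff Topology
open Matrix Complex ComplexConjugate NumberField Set Function MulAction
open Literature.Geometry.ComplexHyperbolic
open Literature.Geometry.ComplexHyperbolic.BallModel
open Literature.Geometry.Kaehler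

namespace Literature.AlgebraicGeometry.ShimuraVarieties

/-! ### A straightening chart with the dimension count -/

section Straightening

variable {M : Type*} [TopologicalSpace M] [ChartedSpace (Fin 2 → ℂ) M] [IsManifold 𝓘(ℂ, Fin 2 → ℂ) 1 M]

/-- **Straightening chart of a regular point, with the dimension count** (Griffiths–Harris Ch. 0 §2:
near a smooth point of codimension `p` an analytic set in a complex surface is a submanifold of
dimension `2 - p`). For a regular point `x` of codimension `p` of `Z ⊆ M`, `M` a complex surface, there
are a subspace `K ⊆ ℂ²` with `dim K + p = 2` and an open partial homeomorphism `e : M ⇀ ℂᵖ × K`,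
`x ∈ e.source`, with `z ∈ Z ↔ (e z).1 = 0` on `e.source` (the proof of
`IsRegularPointOfCodim.exists_straightening`, keeping track of `K = ker` of the onto differential).
[cite: GriffithsHarrisPrinciples1978, Ch. 0 §2, smooth points] -/
theorem IsRegularPointOfCodim.exists_straightening_finrank {Z : Set M} {p : ℕ} {x : M}
    (h : IsRegularPointOfCodim 𝓘(ℂ, Fin 2 → ℂ) Z p x) :
    ∃ (K : Submodule ℂ (Fin 2 → ℂ)) (e : OpenPartialHomeomorph M ((Fin p → ℂ) × K)),
      Module.finrank ℂ K + p = 2 ∧ x ∈ e.source ∧ ∀ z ∈ e.source, z ∈ Z ↔ (e z).1 = 0 := by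
  -- adapted from `Literature.Geometry.Kaehler.IsRegularPointOfCodim.exists_straightening`
  obtain ⟨U, hU, hxU, f, hf, hZU, hsurj⟩ := h
  set φ := chartAt (Fin 2 → ℂ) x with hφ
  have hxφ : x ∈ φ.source := mem_chart_source (Fin 2 → ℂ) x
  set W : Set M := U ∩ φ.source with hWdef
  have hW : IsOpen W := hU.inter φ.open_source
  have hxW : x ∈ W := ⟨hxU, hxφ⟩
  have hmd : MDifferentiableOn 𝓘(ℂ, Fin 2 → ℂ) 𝓘(ℂ, Fin p → ℂ) f W := hf.mono inter_subset_left
  have hdiff : DifferentiableOn ℂ (f ∘ φ.symm) (φ '' W) := by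
    have key := (mdifferentiableOn_iff_of_mem_maximalAtlas (I := 𝓘(ℂ, Fin 2 → ℂ))
      (I' := 𝓘(ℂ, Fin p → ℂ)) (e := φ) (e' := chartAt (Fin p → ℂ) (f x)) (f := f) (s := W)
      (IsManifold.chart_mem_maximalAtlas x) (IsManifold.chart_mem_maximalAtlas (f x))
      inter_subset_right (fun z _ ↦ by simp)).1 hmd
    have h2 := key.2
    simp only [OpenPartialHomeomorph.extend_coe, OpenPartialHomeomorph.extend_coe_symm,
      modelWithCornersSelf_coe, modelWithCornersSelf_coe_symm, chartAt_self_eq,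
      OpenPartialHomeomorph.refl_apply, Function.id_comp, Function.comp_id] at h2
    exact h2
  have hopen : IsOpen (φ '' W) := by
    rw [hWdef, inter_comm, φ.image_source_inter_eq']
    exact φ.isOpen_inter_preimage_symm hU
  have hxW' : φ x ∈ φ '' W := mem_image_of_mem φ hxW
  have han : AnalyticAt ℂ (f ∘ φ.symm) (φ x) :=
    Literature.Analysis.Complex.SCV.analyticAt_of_differentiableOn hdiff hopen hxW'
  have hstrict : HasStrictFDerivAt (f ∘ φ.symm) (fderiv ℂ (f ∘ φ.symm) (φ x)) (φ x) :=
    (han.contDiffAt (n := 1)).hasStrictFDerivAt one_ne_zero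
  have hmdx : MDifferentiableAt 𝓘(ℂ, Fin 2 → ℂ) 𝓘(ℂ, Fin p → ℂ) f x :=
    hf.mdifferentiableAt (hU.mem_nhds hxU)
  have hmf : mfderiv 𝓘(ℂ, Fin 2 → ℂ) 𝓘(ℂ, Fin p → ℂ) f x = fderiv ℂ (f ∘ φ.symm) (φ x) := by
    rw [hmdx.mfderiv, ModelWithCorners.range_eq_univ, fderivWithin_univ]
    rfl
  have hsurj' : (fderiv ℂ (f ∘ φ.symm) (φ x)).range = ⊤ := by
    rw [← hmf]
    exact LinearMap.range_eq_top.2 hsurj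
  have hS : ∀ z ∈ W, z ∈ Z ↔ (f ∘ φ.symm) (φ z) = 0 := by
    intro z hz
    rw [Function.comp_apply, φ.left_inv hz.2]
    have hz' := Set.ext_iff.1 hZU z
    simp only [mem_inter_iff, mem_preimage, mem_singleton_iff] at hz'
    constructor
    · exact fun hzZ ↦ (hz'.1 ⟨hzZ, hz.1⟩).2
    · exact fun h0 ↦ (hz'.2 ⟨hz.1, h0⟩).1
  obtain ⟨e, hxe, he⟩ := exists_straightening_of_hasStrictFDerivAt φ hW hxW inter_subset_right
    hstrict hsurj' hS
  refine ⟨_, e, ?_, hxe, he⟩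
  -- the dimension count: `dim ker + dim range = 2`, `range = ℂᵖ`
  have hrn := (fderiv ℂ (f ∘ φ.symm) (φ x)).toLinearMap.finrank_range_add_finrank_ker
  have hrange : Module.finrank ℂ (LinearMap.range (fderiv ℂ (f ∘ φ.symm) (φ x)).toLinearMap) = p := by
    have : LinearMap.range (fderiv ℂ (f ∘ φ.symm) (φ x)).toLinearMap = ⊤ := hsurj'
    rw [this, finrank_top, Module.finrank_fin_fun]
  rw [hrange, Module.finrank_fin_fun] at hrn
  change Module.finrank ℂ (LinearMap.ker (fderiv ℂ (f ∘ φ.symm) (φ x)).toLinearMap) + p = 2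
  omega

end Straightening

namespace UnitaryBallUniformisationDatum

open Literature.AlgebraicGeometry.Motives (SchemeOver ComplexPoints)

variable {X₂ : SchemeOver ℂ} (D : UnitaryBallUniformisationDatum 2 X₂) (𝔣 : D.SylvesterFrame)

/-! ### The special cycle on the quotient surface `S(Γ)` -/

/-- The **special cycle** of an `E`-subspace `W ⊆ V` on the complex surface `S(Γ) = Δ\𝔹²`: the image of
the special locus `⋃_γ 𝔹((γW)^⊥)` (equivalently of `𝔹(W^⊥)`) under the projection `π : 𝔹² → S(Γ)` —
the cycle `Γ_W\D_W → Γ\D` of Kudla–Millson. [cite: BergeronMillsonMoeglin2016Balls, Introduction §1.7] -/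
def specialCycle (W : Submodule D.E (Fin 3 → D.E)) : Set (D.quotientSurface 𝔣) :=
  D.quotientSurfaceMk 𝔣 '' D.specialLocus 𝔣 W

/-- Two ball points have the same image in `S(Γ)` iff they differ by an element of `Γ`.
[cite: BergeronMillsonMoeglin2016Balls, Introduction §1.1] -/
theorem quotientSurfaceMk_eq_iff (z w : Ball) :
    D.quotientSurfaceMk 𝔣 z = D.quotientSurfaceMk 𝔣 w ↔ ∃ γ : D.Γ, D.ballRep 𝔣 γ • w = z := by
  rw [Literature.Geometry.Manifold.QuotientManifold.mk_eq_mk_iff]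
  constructor
  · rintro ⟨δ, hδ⟩
    obtain ⟨γ, rfl⟩ := D.ballImageMk_surjective 𝔣 δ
    exact ⟨γ, by rw [← ballImageMk_smul]; exact hδ⟩
  · rintro ⟨γ, hγ⟩
    exact ⟨D.ballImageMk 𝔣 γ, by rw [ballImageMk_smul]; exact hγ⟩

/-- Membership in the special cycle is read on any lift: `π z ∈ C_W ↔ z ∈ ⋃_γ 𝔹((γW)^⊥)` (the special
locus is `Γ`-invariant). [cite: BergeronMillsonMoeglin2016Balls, Introduction §1.7] -/
theorem quotientSurfaceMk_mem_specialCycle_iff (W : Submodule D.E (Fin 3 → D.E)) (z : Ball) :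
    D.quotientSurfaceMk 𝔣 z ∈ D.specialCycle 𝔣 W ↔ z ∈ D.specialLocus 𝔣 W := by
  constructor
  · rintro ⟨w, hw, hwz⟩
    obtain ⟨γ, rfl⟩ := (D.quotientSurfaceMk_eq_iff 𝔣 w z).1 hwz
    rwa [smul_mem_specialLocus_iff] at hw
  · exact fun hz ↦ ⟨z, hz, rfl⟩

/-- The preimage of the special cycle under `π` is the special locus.
[cite: BergeronMillsonMoeglin2016Balls, Introduction §1.7] -/
theorem preimage_quotientSurfaceMk_specialCycle (W : Submodule D.E (Fin 3 → D.E)) :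
    D.quotientSurfaceMk 𝔣 ⁻¹' D.specialCycle 𝔣 W = D.specialLocus 𝔣 W :=
  Set.ext fun z ↦ D.quotientSurfaceMk_mem_specialCycle_iff 𝔣 W z

/-- **The special cycle on `S(Γ)` corresponds to the datum's special cycle in `X(ℂ)`**: under the
homeomorphism `S(Γ) ≃ₜ X(ℂ)` it is the preimage of `ballUnifMap '' 𝔹(W^⊥)` (`= unif '' subCone(τ₁ W)`,
`image_unif_subCone_eq`). [cite: BergeronMillsonMoeglin2016Balls, Introduction §1.7] -/
theorem preimage_quotientSurfaceHomeomorph_image_specialBall (W : Submodule D.E (Fin 3 → D.E)) :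
    D.quotientSurfaceHomeomorph 𝔣 ⁻¹' (D.ballUnifMap 𝔣 '' D.specialBall 𝔣 (W : Set (Fin 3 → D.E))) =
      D.specialCycle 𝔣 W := by
  ext m
  obtain ⟨z, rfl⟩ := Quotient.exists_rep m
  have hm : (Quotient.mk _ z : D.quotientSurface 𝔣) = D.quotientSurfaceMk 𝔣 z := rfl
  rw [Set.mem_preimage, hm, quotientSurfaceHomeomorph_mk, ballUnifMap_mem_image_specialBall_iff,
    quotientSurfaceMk_mem_specialCycle_iff]

/-- The special cycle is closed in `S(Γ)`. [cite: KudlaMillson1990, Lemma 1.1, p. 128] -/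
theorem isClosed_specialCycle (W : Submodule D.E (Fin 3 → D.E)) : IsClosed (D.specialCycle 𝔣 W) := by
  rw [← preimage_quotientSurfaceHomeomorph_image_specialBall]
  exact (D.isClosed_image_specialBall 𝔣 W).preimage (D.quotientSurfaceHomeomorph 𝔣).continuous

/-! ### The defining holomorphic functions -/

/-- The affine function of the ball coordinates representing the pairing with `s ∈ V`:
`ℓ_s(u) = b₀ u₀ + b₁ u₁ + b₂`, `b = ballVec s`. [cite: BergeronMillsonMoeglin2016Balls, Part 2 §1.3] -/
def affFun (s : Fin 3 → D.E) (u : Fin 2 → ℂ) : ℂ :=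
  D.ballVec 𝔣 s 0 * u 0 + D.ballVec 𝔣 s 1 * u 1 + D.ballVec 𝔣 s 2

/-- `ℓ_s` is the pairing: `ℓ_s(z) = ⟪τ₁ s, T(z,1)⟫` on the ball.
[cite: BergeronMillsonMoeglin2016Balls, Part 2 §1.3] -/
theorem affFun_coe (s : Fin 3 → D.E) (z : Ball) :
    D.affFun 𝔣 s z.1 = D.pairE s (D.coneLift 𝔣 z : Fin 3 → ℂ) := by
  rw [affFun, pairE_coneLift_eq_ballVec]

/-- `ℓ_s` is holomorphic (`C^ω`) on `ℂ²` (an affine function of the ball coordinates).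
[cite: BergeronMillsonMoeglin2016Balls, Part 2 §1.3] -/
theorem contDiff_affFun (s : Fin 3 → D.E) : ContDiff ℂ ω (D.affFun 𝔣 s) := by
  unfold affFun
  fun_prop

/-- A special sub-ball `𝔹((γW)^⊥)` is cut out by the `dim W` affine functions of the translated basis
vectors. [cite: BergeronMillsonMoeglin2016Balls, Part 2 §3.3] -/
theorem mem_specialBall_translate_iff {ι : Type*} (W : Submodule D.E (Fin 3 → D.E))
    (b : Module.Basis ι D.E W) (γ : D.Γ) (z : Ball) :
    z ∈ D.specialBall 𝔣 (D.vact γ '' (W : Set (Fin 3 → D.E))) ↔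
      ∀ i, D.affFun 𝔣 (D.vact γ (b i : W)) z.1 = 0 := by
  -- `γW` is spanned by the translated basis
  set f := Matrix.mulVecLin ((γ : GL (Fin 3) D.E) : Matrix (Fin 3) (Fin 3) D.E) with hfdef
  have hW : Submodule.span D.E (Set.range fun i ↦ ((b i : W) : Fin 3 → D.E)) = W := by
    have := congrArg (Submodule.map W.subtype) b.span_eq
    rw [Submodule.map_span, Submodule.map_subtype_top, ← Set.range_comp] at this
    exact this
  have hmapW : W.map f = Submodule.span D.E (Set.range fun i ↦ D.vact γ (b i : W)) := by
    conv_lhs => rw [← hW]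
    rw [Submodule.map_span, ← Set.range_comp]
    rfl
  have hspan : Submodule.span D.E (Set.range fun i ↦ D.vact γ (b i : W)) =
      Submodule.span D.E (D.vact γ '' (W : Set (Fin 3 → D.E))) := by
    rw [vact_image_coe, Submodule.span_eq, ← hfdef, hmapW]
  rw [← D.specialBall_span 𝔣 (D.vact γ '' (W : Set (Fin 3 → D.E))), ← hspan, D.specialBall_span,
    mem_specialBall_iff]
  simp only [Set.forall_mem_range, affFun_coe]

/-- **Product trick**: a point lies in a finite union of common zero sets `⋂ᵢ {ℓ_{j,i} = 0}` iff all
the products `∏ⱼ ℓ_{j,σ(j)}` over choice functions `σ` vanish at it. [folklore] -/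
private theorem mem_iUnion_zero_iff_forall_prod {J ι : Type*} [Fintype J] (ℓ : J → ι → ℂ) :
    (∃ j, ∀ i, ℓ j i = 0) ↔ ∀ σ : J → ι, ∏ j, ℓ j (σ j) = 0 := by
  constructor
  · rintro ⟨j, hj⟩ σ
    exact Finset.prod_eq_zero (Finset.mem_univ j) (hj (σ j))
  · intro h
    by_contra hne
    push Not at hne
    choose σ hσ using hne
    exact (Finset.prod_ne_zero_iff.2 fun j _ ↦ hσ j) (h σ)

/-! ### The special cycle is an analytic subset of `S(Γ)` -/

/-- **Special cycles are analytic subsets of `S(Γ)`**: near every point of the compact complex surface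
`Δ\𝔹²` the special cycle of `W` is the common zero set of finitely many holomorphic functions (products
of the affine functions `⟪τ₁(γⱼ bᵢ), T(·,1)⟫` over the finitely many special sub-balls through a
neighbourhood, composed with a holomorphic local inverse of the projection).
[cite: KudlaMillson1990, Lemma 1.1, p. 128] [cite: BergeronMillsonMoeglin2016Balls, Introduction §1.7] -/
theorem isAnalyticSet_specialCycle (W : Submodule D.E (Fin 3 → D.E)) :
    IsAnalyticSet 𝓘(ℂ, Fin 2 → ℂ) (D.specialCycle 𝔣 W) := by
  classical
  intro x
  obtain ⟨z, rfl⟩ := Quotient.exists_rep x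
  change IsAnalyticSetAt 𝓘(ℂ, Fin 2 → ℂ) (D.specialCycle 𝔣 W) (D.quotientSurfaceMk 𝔣 z)
  -- a holomorphic local inverse `σ` of the projection at `z`
  have hloc := D.isLocalDiffeomorph_quotientSurfaceMk 𝔣 z
  set σ := hloc.localInverse with hσ
  -- the special locus near `z` is a finite union of translates
  obtain ⟨U, F, hU, hzU, hF, hFW, hloc_eq⟩ := D.exists_isOpen_specialLocus_inter_eq 𝔣 W z
  choose γ hγ using hFW
  haveI : Fintype F := hF.fintype
  let b := Module.finBasis D.E W
  -- the open set `V ∋ π z` on which `σ` lands in `U`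
  set V : Set (D.quotientSurface 𝔣) := σ.source ∩ σ ⁻¹' U with hV
  have hVopen : IsOpen V :=
    (σ.contMDiffOn_toFun.continuousOn).isOpen_inter_preimage σ.open_source hU
  have hzV : D.quotientSurfaceMk 𝔣 z ∈ V := by
    refine ⟨hloc.localInverse_mem_source, ?_⟩
    rw [Set.mem_preimage, hσ, hloc.localInverse_left_inv hloc.localInverse_mem_target]
    exact hzU
  -- the defining map: products over choice functions, reindexed by `Fin m`
  set eσ := Fintype.equivFin (F → Fin (Module.finrank D.E W)) with heσ
  set G : (Fin 2 → ℂ) → (Fin (Fintype.card (F → Fin (Module.finrank D.E W))) → ℂ) :=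
    fun u j ↦ ∏ B : F, D.affFun 𝔣 (D.vact (γ B B.2) (b ((eσ.symm j) B) : W)) u with hG
  have hGdiff : ContDiff ℂ ω G := by
    rw [contDiff_pi]
    intro j
    exact contDiff_prod fun B _ ↦ D.contDiff_affFun 𝔣 _
  set f : D.quotientSurface 𝔣 → (Fin (Fintype.card (F → Fin (Module.finrank D.E W))) → ℂ) :=
    fun y ↦ G ((σ y).1) with hf
  refine ⟨V, hVopen, hzV, _, f, ?_, ?_⟩
  · -- holomorphy of `f = G ∘ coe ∘ σ` on `V`
    have h1 : ContMDiffOn 𝓘(ℂ, Fin 2 → ℂ) 𝓘(ℂ, Fin 2 → ℂ) ω (fun y ↦ ((σ y).1 : Fin 2 → ℂ)) V :=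
      (BallModel.contMDiff_coe.comp_contMDiffOn σ.contMDiffOn_toFun).mono inter_subset_left
    have h2 : ContMDiffOn 𝓘(ℂ, Fin 2 → ℂ) 𝓘(ℂ, Fin _ → ℂ) ω f V :=
      fun y hy ↦ hGdiff.comp_contMDiffWithinAt (h1 y hy)
    exact h2.mdifferentiableOn (by simp)
  · -- the zero set
    ext y
    constructor
    · rintro ⟨hy, hyV⟩
      refine ⟨hyV, ?_⟩
      rw [Set.mem_preimage, Set.mem_singleton_iff]
      -- `σ y` lies in the special locus and in `U`, hence in some translate of `F`
      have hσy : σ y ∈ D.specialLocus 𝔣 W := by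
        have hπ : D.quotientSurfaceMk 𝔣 (σ y) = y := hloc.localInverse_right_inv hyV.1
        rw [← quotientSurfaceMk_mem_specialCycle_iff, hπ]
        exact hy
      have hmem : σ y ∈ ⋃₀ F ∩ U := by rw [← hloc_eq]; exact ⟨hσy, hyV.2⟩
      obtain ⟨B, hBF, hB⟩ := Set.mem_sUnion.1 hmem.1
      funext j
      rw [hf, hG]
      simp only [Pi.zero_apply]
      refine Finset.prod_eq_zero (Finset.mem_univ ⟨B, hBF⟩) ?_
      have hB' : σ y ∈ D.specialBall 𝔣 (D.vact (γ B hBF) '' (W : Set (Fin 3 → D.E))) := by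
        rw [hγ B hBF]; exact hB
      exact (D.mem_specialBall_translate_iff 𝔣 W b (γ B hBF) (σ y)).1 hB' _
    · rintro ⟨hyV, hy0⟩
      refine ⟨?_, hyV⟩
      rw [Set.mem_preimage, Set.mem_singleton_iff] at hy0
      have hπ : D.quotientSurfaceMk 𝔣 (σ y) = y := hloc.localInverse_right_inv hyV.1
      rw [← hπ, quotientSurfaceMk_mem_specialCycle_iff]
      -- all products vanish, hence `σ y` lies on one of the translates
      have hall : ∀ ρ : F → Fin (Module.finrank D.E W),
          ∏ B : F, D.affFun 𝔣 (D.vact (γ B B.2) (b (ρ B) : W)) (σ y).1 = 0 := by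
        intro ρ
        have := congrFun hy0 (eσ ρ)
        rw [hf, hG] at this
        simpa [Equiv.symm_apply_apply] using this
      obtain ⟨B, hB⟩ := (mem_iUnion_zero_iff_forall_prod
        (fun (B : F) i ↦ D.affFun 𝔣 (D.vact (γ B B.2) (b i : W)) (σ y).1)).2 hall
      have hmemB : σ y ∈ D.specialBall 𝔣 (D.vact (γ B B.2) '' (W : Set (Fin 3 → D.E))) :=
        (D.mem_specialBall_translate_iff 𝔣 W b (γ B B.2) (σ y)).2 hB
      have : σ y ∈ ⋃₀ F ∩ U := ⟨Set.mem_sUnion.2 ⟨B, B.2, by rw [← hγ B B.2]; exact hmemB⟩, hyV.2⟩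
      rw [← hloc_eq] at this
      exact this.1

/-! ### Regular points of the special cycle have codimension `≥ dim_E W` -/

/-- An open subset of `S(Γ)` inside the special cycle forces the special locus to have non-empty
interior. [cite: BergeronMillsonMoeglin2016Balls, Introduction §1.7] -/
theorem interior_specialLocus_nonempty_of_subset {W : Submodule D.E (Fin 3 → D.E)}
    {O : Set (D.quotientSurface 𝔣)} (hO : IsOpen O) (hne : O.Nonempty) (hsub : O ⊆ D.specialCycle 𝔣 W) :
    (interior (D.specialLocus 𝔣 W)).Nonempty := by
  obtain ⟨x, hx⟩ := hne
  obtain ⟨z, rfl⟩ := Quotient.exists_rep x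
  refine ⟨z, mem_interior.2 ⟨D.quotientSurfaceMk 𝔣 ⁻¹' O, ?_, hO.preimage (D.contMDiff_quotientSurfaceMk 𝔣).continuous, hx⟩⟩
  rw [← preimage_quotientSurfaceMk_specialCycle]
  exact Set.preimage_mono hsub

/-- For `dim_E W = 2` the special cycle is discrete: each of its points is isolated.
[cite: BergeronMillsonMoeglin2016Balls, Introduction §1.7] -/
theorem exists_isOpen_specialCycle_inter_subset_of_finrank_eq_two {W : Submodule D.E (Fin 3 → D.E)}
    (h2 : Module.finrank D.E W = 2) (x : D.quotientSurface 𝔣) :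
    ∃ O : Set (D.quotientSurface 𝔣), IsOpen O ∧ x ∈ O ∧ D.specialCycle 𝔣 W ∩ O ⊆ {x} := by
  obtain ⟨z, rfl⟩ := Quotient.exists_rep x
  change ∃ O, IsOpen O ∧ D.quotientSurfaceMk 𝔣 z ∈ O ∧ D.specialCycle 𝔣 W ∩ O ⊆ {D.quotientSurfaceMk 𝔣 z}
  have hloc := D.isLocalDiffeomorph_quotientSurfaceMk 𝔣 z
  set σ := hloc.localInverse with hσ
  -- a neighbourhood `U` of `z` in the ball meeting the special locus in `{z}` at most
  obtain ⟨K, hK, hKz⟩ := exists_compact_mem_nhds z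
  have hfin : ((D.specialLocus 𝔣 W ∩ K) \ {z}).Finite :=
    (D.finite_specialLocus_inter_of_finrank_eq_two 𝔣 h2 hK).subset fun _ h ↦ h.1
  have hclosed : IsClosed ((D.specialLocus 𝔣 W ∩ K) \ {z}) := hfin.isClosed
  set U : Set Ball := interior K ∩ ((D.specialLocus 𝔣 W ∩ K) \ {z})ᶜ with hUdef
  have hU : IsOpen U := isOpen_interior.inter hclosed.isOpen_compl
  have hzU : z ∈ U := ⟨mem_interior_iff_mem_nhds.2 hKz, fun h ↦ h.2 rfl⟩
  have hUz : ∀ w ∈ U, w ∈ D.specialLocus 𝔣 W → w = z := by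
    rintro w ⟨hwK, hwc⟩ hw
    by_contra hne
    exact hwc ⟨⟨hw, interior_subset hwK⟩, hne⟩
  refine ⟨σ.source ∩ σ ⁻¹' U,
    (σ.contMDiffOn_toFun.continuousOn).isOpen_inter_preimage σ.open_source hU, ⟨hloc.localInverse_mem_source, ?_⟩, ?_⟩
  · rw [Set.mem_preimage, hσ, hloc.localInverse_left_inv hloc.localInverse_mem_target]
    exact hzU
  · rintro y ⟨hy, hysrc, hyU⟩
    have hπ : D.quotientSurfaceMk 𝔣 (σ y) = y := hloc.localInverse_right_inv hysrc
    have hσy : σ y ∈ D.specialLocus 𝔣 W := by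
      rw [← quotientSurfaceMk_mem_specialCycle_iff, hπ]; exact hy
    rw [Set.mem_singleton_iff, ← hπ, hUz (σ y) hyU hσy]

/-- **Regular points of the special cycle have codimension at least `dim_E W`.** If `x ∈ C_W` is a
regular point of codimension `q` of the special cycle `C_W ⊆ S(Γ)`, then `dim_E W ≤ q`: a regular point of
codimension `0` would make `C_W` contain an open set (but the special locus of `W ≠ 0` has empty
interior), a regular point of codimension `1` is not isolated (straightening chart `ℂ × K`, `dim K = 1`),
while for `dim_E W = 2` the cycle is discrete, and for `W = V` it is empty.
[cite: BergeronMillsonMoeglin2016Balls, Introduction §1.7] [cite: GriffithsHarrisPrinciples1978, Ch. 0 §2] -/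
theorem finrank_le_of_isRegularPointOfCodim (W : Submodule D.E (Fin 3 → D.E)) {x : D.quotientSurface 𝔣}
    (hx : x ∈ D.specialCycle 𝔣 W) {q : ℕ} (hreg : IsRegularPointOfCodim 𝓘(ℂ, Fin 2 → ℂ) (D.specialCycle 𝔣 W) q x) :
    Module.finrank D.E W ≤ q := by
  set k := Module.finrank D.E W with hk
  have hk3 : k ≤ 3 := by
    have := Submodule.finrank_le W
    simpa using this
  -- `W = V` gives an empty cycle
  have hk3' : k ≠ 3 := by
    intro h3
    have hW : W = ⊤ := Submodule.eq_top_of_finrank_eq (by simpa using h3)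
    obtain ⟨z, rfl⟩ := Quotient.exists_rep x
    have hz := (D.quotientSurfaceMk_mem_specialCycle_iff 𝔣 W z).1 hx
    rw [hW, specialLocus_top] at hz
    exact hz
  obtain ⟨K, e, hdim, hxe, he⟩ := IsRegularPointOfCodim.exists_straightening_finrank hreg
  by_contra hlt
  push Not at hlt
  -- so `q ≤ 1` and `k ≥ 1`
  have hWne : W ≠ ⊥ := by
    intro hbot
    have : k = 0 := by rw [hk, hbot, finrank_bot]
    omega
  rcases Nat.lt_or_ge q 1 with hq0 | hq1
  · -- `q = 0`: the cycle contains the open set `e.source`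
    have hq : q = 0 := by omega
    subst hq
    have hsub : e.source ⊆ D.specialCycle 𝔣 W := fun y hy ↦ (he y hy).2 (Subsingleton.elim _ _)
    have hne := D.interior_specialLocus_nonempty_of_subset 𝔣 e.open_source ⟨x, hxe⟩ hsub
    rw [D.interior_specialLocus_eq_empty 𝔣 hWne] at hne
    exact Set.not_nonempty_empty hne
  · -- `q = 1`, `k = 2`: a non-isolated point of a discrete set
    have hq : q = 1 := by omega
    subst hq
    have hk2 : k = 2 := by omega
    have hK : Module.finrank ℂ K = 1 := by omega
    obtain ⟨O, hO, hxO, hOsub⟩ := D.exists_isOpen_specialCycle_inter_subset_of_finrank_eq_two 𝔣 hk2 x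
    -- the straightened picture: `e(e.source ∩ O)` is an open neighbourhood of `e x = (0, κ)`
    set O' : Set ((Fin 1 → ℂ) × K) := e '' (e.source ∩ O) with hO'
    have hO'open : IsOpen O' := e.isOpen_image_of_subset_source (e.open_source.inter hO) inter_subset_left
    have hxO' : e x ∈ O' := ⟨x, ⟨hxe, hxO⟩, rfl⟩
    -- a non-zero vector of `K`
    obtain ⟨κ₁, hκ₁⟩ : ∃ κ₁ : K, κ₁ ≠ 0 := by
      have : Nontrivial K := Module.nontrivial_of_finrank_eq_succ hK
      exact exists_ne 0
    -- move a little in the `K`-direction inside `O'`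
    obtain ⟨ε, hε, hball⟩ := Metric.isOpen_iff.1 hO'open (e x) hxO'
    set t : ℝ := ε / (2 * (‖κ₁‖ + 1)) with ht
    have htpos : 0 < t := by positivity
    set p : (Fin 1 → ℂ) × K := ((e x).1, (e x).2 + (t : ℂ) • κ₁) with hp
    have hpball : p ∈ Metric.ball (e x) ε := by
      rw [Metric.mem_ball, Prod.dist_eq, hp]
      simp only [dist_self, dist_eq_norm, add_sub_cancel_left, norm_smul, Complex.norm_real,
        Real.norm_eq_abs, abs_of_pos htpos]
      rw [max_eq_right (by positivity)]
      calc t * ‖κ₁‖ ≤ t * (‖κ₁‖ + 1) := by gcongr; linarith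
        _ = ε / 2 := by rw [ht]; field_simp
        _ < ε := by linarith
    obtain ⟨y, ⟨hye, hyO⟩, hyp⟩ := hball hpball
    -- `y` lies on the cycle (its first coordinate vanishes, as that of `e x`) and in `O`, so `y = x`
    have hx0 : (e x).1 = 0 := (he x hxe).1 hx
    have hy : y ∈ D.specialCycle 𝔣 W := (he y hye).2 (by rw [hyp, hp]; exact hx0)
    have hyx : y = x := hOsub ⟨hy, hyO⟩
    rw [hyx] at hyp
    have : (t : ℂ) • κ₁ = 0 := by
      have h2 := congrArg Prod.snd hyp
      rw [hp] at h2
      simpa using h2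
    rw [smul_eq_zero] at this
    rcases this with h | h
    · exact htpos.ne' (by exact_mod_cast h)
    · exact hκ₁ h

/-- The codimension bound in the form consumed by the GAGA dimension comparison
(`gaga_le_coheight_of_regularLocus_codim`): every regular point of the special cycle, of whatever
codimension `q`, has `dim_E W ≤ q`. [cite: BergeronMillsonMoeglin2016Balls, Introduction §1.7] -/
theorem finrank_le_of_mem_regularLocus (W : Submodule D.E (Fin 3 → D.E)) :
    ∀ x ∈ regularLocus 𝓘(ℂ, Fin 2 → ℂ) (D.specialCycle 𝔣 W), ∀ q : ℕ,
      IsRegularPointOfCodim 𝓘(ℂ, Fin 2 → ℂ) (D.specialCycle 𝔣 W) q x → Module.finrank D.E W ≤ q :=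
  fun _ hx _ hq ↦ D.finrank_le_of_isRegularPointOfCodim 𝔣 W hx.1 hq

end UnitaryBallUniformisationDatum

end Literature.AlgebraicGeometry.ShimuraVarieties

end
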